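import Summits.CriticalPhenomena.PercolationContinuityZ3.Theorems.PercNearOneGluingNoHeavyLowerTailThreePointProductFormFibreParallelEvents
import HarnessLib

/-!
# Parallel composition at the three terminals, III: the six fibre statistics multiply (Sahi programme, prover prim-sahi-p2 gen 59)

Support file (`--supports stmt-CriticalPhenomena-4575`, helper); continues `…ThreePointProductFormFibreParallelEvents` (same gen).
Standard axioms, no sorries, no named facts, no definitions.  Memo `run/shared/lean/prim/prim-sahi/FROM-prim-sahi-p2-gen59-ONE-STEP-LEMMA.md`
§3, §8(2); `prim-sahi-p2/PROOF-E3.md` (63h), (63k), §69.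

A PIECE is a label class `Q` (other labels read as closed: `z|_Q = fun l => z l && decide (Q l)`); its six statistics w.r.t. `(s, a, c)` are the
numbers of configurations `z` with, for `x = z|_Q` and the restricted flat `(♭x)|_Q` (`♭x = clusterFlip ends a x̄`): `S0: s, c isolated in x`;
`S0∪P1: c isolated`; `S0∪P2: s isolated`; `Ga: S0 ∧ c isolated in (♭x)|_Q`; `Gb: S0 ∧ s isolated in (♭x)|_Q`; `G1: S0 ∧ both isolated in (♭x)|_Q`
('isolated' = from the other two terminals); `#bad = #S0 − Ga − Gb + G1` (gen 53 (63k)).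
**THEOREM (`card_parallel_S0`, `card_parallel_isoC`, `card_parallel_isoS`, `card_parallel_Ga`, `card_parallel_Gb`, `card_parallel_G1`).**
If `Q₁, Q₂` are disjoint label classes living on disjoint terminal-free vertex classes `P₁, P₂` (`Qᵢ`-labels have endpoints in
`Pᵢ ∪ {s,a,c}`), then for each of the six statistics `E`:  `#E(Q₁ ∪ Q₂) · 2^{#α} = #E(Q₁) · #E(Q₂)` — PARALLEL COMPOSITION AT `{s,a,c}`
MULTIPLIES THE (normalised) STATISTICS (gen 53's zeta coordinates (63k), now a theorem).  With the one-step lemma (`…ThreePointProductFormOneStep`)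
this is the route to (P) on tree-like fibres as a graph theorem (memo §8(2): series pieces and the assembly remain).
[this work] (gen 59).
-/

namespace Summit.CriticalPhenomena.PercolationContinuityZ3.Theorems.ProductFormFibre

open Finset Literature.Probability.Percolation
open Summit.CriticalPhenomena.PercolationContinuityZ3.Theorems.ThreePointCPIClusterSwap (clusterFlip)

variable {V α : Type*}

/-! ### The product law -/

section Counts

variable [Fintype α] [DecidableEq α] [DecidableEq V]
variable (ends : α → Sym2 V) (s a c : V) (P₁ P₂ : V → Prop) (Q₁ Q₂ : α → Prop) [DecidablePred Q₁] [DecidablePred Q₂]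

omit [DecidableEq V] in
/-- Generic product count: an event of `z` that is pointwise the conjunction of an event of `z|_{Q₁}` and an event of `z|_{Q₂}`
(disjoint classes) satisfies `#E · #univ = #E₁ · #E₂`. [this work] -/
theorem card_mul_univ_of_restrict_split (hQ : ∀ l, Q₁ l → ¬ Q₂ l)
    (E : (α → Bool) → Prop) (G₁ G₂ : (α → Bool) → Prop) [DecidablePred E] [DecidablePred G₁] [DecidablePred G₂]
    (hE : ∀ z, E z ↔ G₁ (fun l => z l && decide (Q₁ l)) ∧ G₂ (fun l => z l && decide (Q₂ l))) :
    (univ.filter E).card * (univ : Finset (α → Bool)).card =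
      (univ.filter fun z : α → Bool => G₁ (fun l => z l && decide (Q₁ l))).card *
      (univ.filter fun z : α → Bool => G₂ (fun l => z l && decide (Q₂ l))).card := by
  classical
  have h := card_and_mul_card_univ Q₁ (fun z : α → Bool => G₁ (fun l => z l && decide (Q₁ l)))
    (fun z : α → Bool => G₂ (fun l => z l && decide (Q₂ l)))
    (fun z z' hzz' hz => by
      have : (fun l => z l && decide (Q₁ l)) = (fun l => z' l && decide (Q₁ l)) := by
        funext l; by_cases hl : Q₁ l
        · simp [hl, hzz' l hl]
        · simp [hl]
      show G₁ (fun l => z' l && decide (Q₁ l))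
      rw [← this]; exact hz)
    (fun z z' hzz' hz => by
      have : (fun l => z l && decide (Q₂ l)) = (fun l => z' l && decide (Q₂ l)) := by
        funext l; by_cases hl : Q₂ l
        · have h1 : ¬ Q₁ l := fun h => hQ l h hl
          simp [hl, hzz' l h1]
        · simp [hl]
      show G₂ (fun l => z' l && decide (Q₂ l))
      rw [← this]; exact hz)
  rw [← h]
  congr 2
  exact Finset.filter_congr fun z _ => hE z

open Classical in
/-- **`#S0` multiplies under parallel composition**: `#{s, c isolated in z|_{Q₁∪Q₂}} · 2^{#α} = #{… z|_{Q₁}} · #{… z|_{Q₂}}`. [this work] -/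
theorem card_parallel_S0
    (hQP₁ : ∀ l, Q₁ l → ∀ v ∈ ends l, P₁ v ∨ (v = s ∨ v = a ∨ v = c))
    (hQP₂ : ∀ l, Q₂ l → ∀ v ∈ ends l, P₂ v ∨ (v = s ∨ v = a ∨ v = c))
    (hPT₁ : ∀ v, P₁ v → ¬ (v = s ∨ v = a ∨ v = c)) (hPT₂ : ∀ v, P₂ v → ¬ (v = s ∨ v = a ∨ v = c))
    (hP : ∀ v, P₁ v → ¬ P₂ v) (hQ : ∀ l, Q₁ l → ¬ Q₂ l) :
    (univ.filter fun z : α → Bool =>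
      (¬ (openGraph (labelledOpen ends fun l => z l && decide (Q₁ l ∨ Q₂ l))).Reachable s a ∧
       ¬ (openGraph (labelledOpen ends fun l => z l && decide (Q₁ l ∨ Q₂ l))).Reachable s c) ∧
      (¬ (openGraph (labelledOpen ends fun l => z l && decide (Q₁ l ∨ Q₂ l))).Reachable c a ∧
       ¬ (openGraph (labelledOpen ends fun l => z l && decide (Q₁ l ∨ Q₂ l))).Reachable c s)).card *
    (univ : Finset (α → Bool)).card =
    (univ.filter fun z : α → Bool =>
      (¬ (openGraph (labelledOpen ends fun l => z l && decide (Q₁ l))).Reachable s a ∧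
       ¬ (openGraph (labelledOpen ends fun l => z l && decide (Q₁ l))).Reachable s c) ∧
      (¬ (openGraph (labelledOpen ends fun l => z l && decide (Q₁ l))).Reachable c a ∧
       ¬ (openGraph (labelledOpen ends fun l => z l && decide (Q₁ l))).Reachable c s)).card *
    (univ.filter fun z : α → Bool =>
      (¬ (openGraph (labelledOpen ends fun l => z l && decide (Q₂ l))).Reachable s a ∧
       ¬ (openGraph (labelledOpen ends fun l => z l && decide (Q₂ l))).Reachable s c) ∧
      (¬ (openGraph (labelledOpen ends fun l => z l && decide (Q₂ l))).Reachable c a ∧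
       ¬ (openGraph (labelledOpen ends fun l => z l && decide (Q₂ l))).Reachable c s)).card := by
  refine card_mul_univ_of_restrict_split Q₁ Q₂ hQ _
    (fun x => (¬ (openGraph (labelledOpen ends x)).Reachable s a ∧ ¬ (openGraph (labelledOpen ends x)).Reachable s c) ∧
      (¬ (openGraph (labelledOpen ends x)).Reachable c a ∧ ¬ (openGraph (labelledOpen ends x)).Reachable c s))
    (fun x => (¬ (openGraph (labelledOpen ends x)).Reachable s a ∧ ¬ (openGraph (labelledOpen ends x)).Reachable s c) ∧
      (¬ (openGraph (labelledOpen ends x)).Reachable c a ∧ ¬ (openGraph (labelledOpen ends x)).Reachable c s))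
    fun z => ?_
  obtain ⟨hs, hc, -⟩ := events_split ends s a c P₁ P₂ Q₁ Q₂ hQP₁ hQP₂ hPT₁ hPT₂ hP z
  rw [hs, hc]
  tauto


open Classical in
/-- **`#(S0 ∪ P1)` (c isolated) multiplies under parallel composition**: `#E(Q₁∪Q₂) · 2^{#α} = #E(Q₁) · #E(Q₂)`. [this work] -/
theorem card_parallel_isoC
    (hQP₁ : ∀ l, Q₁ l → ∀ v ∈ ends l, P₁ v ∨ (v = s ∨ v = a ∨ v = c))
    (hQP₂ : ∀ l, Q₂ l → ∀ v ∈ ends l, P₂ v ∨ (v = s ∨ v = a ∨ v = c))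
    (hPT₁ : ∀ v, P₁ v → ¬ (v = s ∨ v = a ∨ v = c)) (hPT₂ : ∀ v, P₂ v → ¬ (v = s ∨ v = a ∨ v = c))
    (hP : ∀ v, P₁ v → ¬ P₂ v) (hQ : ∀ l, Q₁ l → ¬ Q₂ l) :
    (univ.filter fun z : α → Bool =>
        (¬ (openGraph (labelledOpen ends fun l => z l && decide (Q₁ l ∨ Q₂ l))).Reachable c a ∧
        ¬ (openGraph (labelledOpen ends fun l => z l && decide (Q₁ l ∨ Q₂ l))).Reachable c s)).card *
      (univ : Finset (α → Bool)).card =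
    (univ.filter fun z : α → Bool =>
        (¬ (openGraph (labelledOpen ends fun l => z l && decide (Q₁ l))).Reachable c a ∧
        ¬ (openGraph (labelledOpen ends fun l => z l && decide (Q₁ l))).Reachable c s)).card *
    (univ.filter fun z : α → Bool =>
        (¬ (openGraph (labelledOpen ends fun l => z l && decide (Q₂ l))).Reachable c a ∧
        ¬ (openGraph (labelledOpen ends fun l => z l && decide (Q₂ l))).Reachable c s)).card := by
  refine card_mul_univ_of_restrict_split Q₁ Q₂ hQ _
    (fun w =>
        (¬ (openGraph (labelledOpen ends w)).Reachable c a ∧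
        ¬ (openGraph (labelledOpen ends w)).Reachable c s))
    (fun w =>
        (¬ (openGraph (labelledOpen ends w)).Reachable c a ∧
        ¬ (openGraph (labelledOpen ends w)).Reachable c s))
    fun z => ?_
  obtain ⟨hs, hc, hF⟩ := events_split ends s a c P₁ P₂ Q₁ Q₂ hQP₁ hQP₂ hPT₁ hPT₂ hP z
  constructor
  · intro h
    exact hc.1 h
  · intro h
    exact hc.2 h


open Classical in
/-- **`#(S0 ∪ P2)` (s isolated) multiplies under parallel composition**: `#E(Q₁∪Q₂) · 2^{#α} = #E(Q₁) · #E(Q₂)`. [this work] -/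
theorem card_parallel_isoS
    (hQP₁ : ∀ l, Q₁ l → ∀ v ∈ ends l, P₁ v ∨ (v = s ∨ v = a ∨ v = c))
    (hQP₂ : ∀ l, Q₂ l → ∀ v ∈ ends l, P₂ v ∨ (v = s ∨ v = a ∨ v = c))
    (hPT₁ : ∀ v, P₁ v → ¬ (v = s ∨ v = a ∨ v = c)) (hPT₂ : ∀ v, P₂ v → ¬ (v = s ∨ v = a ∨ v = c))
    (hP : ∀ v, P₁ v → ¬ P₂ v) (hQ : ∀ l, Q₁ l → ¬ Q₂ l) :
    (univ.filter fun z : α → Bool =>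
        (¬ (openGraph (labelledOpen ends fun l => z l && decide (Q₁ l ∨ Q₂ l))).Reachable s a ∧
        ¬ (openGraph (labelledOpen ends fun l => z l && decide (Q₁ l ∨ Q₂ l))).Reachable s c)).card *
      (univ : Finset (α → Bool)).card =
    (univ.filter fun z : α → Bool =>
        (¬ (openGraph (labelledOpen ends fun l => z l && decide (Q₁ l))).Reachable s a ∧
        ¬ (openGraph (labelledOpen ends fun l => z l && decide (Q₁ l))).Reachable s c)).card *
    (univ.filter fun z : α → Bool =>
        (¬ (openGraph (labelledOpen ends fun l => z l && decide (Q₂ l))).Reachable s a ∧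
        ¬ (openGraph (labelledOpen ends fun l => z l && decide (Q₂ l))).Reachable s c)).card := by
  refine card_mul_univ_of_restrict_split Q₁ Q₂ hQ _
    (fun w =>
        (¬ (openGraph (labelledOpen ends w)).Reachable s a ∧
        ¬ (openGraph (labelledOpen ends w)).Reachable s c))
    (fun w =>
        (¬ (openGraph (labelledOpen ends w)).Reachable s a ∧
        ¬ (openGraph (labelledOpen ends w)).Reachable s c))
    fun z => ?_
  obtain ⟨hs, hc, hF⟩ := events_split ends s a c P₁ P₂ Q₁ Q₂ hQP₁ hQP₂ hPT₁ hPT₂ hP z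
  constructor
  · intro h
    exact hs.1 h
  · intro h
    exact hs.2 h


open Classical in
/-- **`Ga` (S0, and c isolated in the restricted flat) multiplies under parallel composition**: `#E(Q₁∪Q₂) · 2^{#α} = #E(Q₁) · #E(Q₂)`. [this work] -/
theorem card_parallel_Ga
    (hQP₁ : ∀ l, Q₁ l → ∀ v ∈ ends l, P₁ v ∨ (v = s ∨ v = a ∨ v = c))
    (hQP₂ : ∀ l, Q₂ l → ∀ v ∈ ends l, P₂ v ∨ (v = s ∨ v = a ∨ v = c))
    (hPT₁ : ∀ v, P₁ v → ¬ (v = s ∨ v = a ∨ v = c)) (hPT₂ : ∀ v, P₂ v → ¬ (v = s ∨ v = a ∨ v = c))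
    (hP : ∀ v, P₁ v → ¬ P₂ v) (hQ : ∀ l, Q₁ l → ¬ Q₂ l) :
    (univ.filter fun z : α → Bool =>
        (((¬ (openGraph (labelledOpen ends fun l => z l && decide (Q₁ l ∨ Q₂ l))).Reachable s a ∧
        ¬ (openGraph (labelledOpen ends fun l => z l && decide (Q₁ l ∨ Q₂ l))).Reachable s c) ∧
        (¬ (openGraph (labelledOpen ends fun l => z l && decide (Q₁ l ∨ Q₂ l))).Reachable c a ∧
        ¬ (openGraph (labelledOpen ends fun l => z l && decide (Q₁ l ∨ Q₂ l))).Reachable c s)) ∧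
        (¬ (openGraph (labelledOpen ends fun l =>
          clusterFlip ends a (fun y => !(z y && decide (Q₁ y ∨ Q₂ y))) l && decide (Q₁ l ∨ Q₂ l))).Reachable c a ∧
        ¬ (openGraph (labelledOpen ends fun l =>
          clusterFlip ends a (fun y => !(z y && decide (Q₁ y ∨ Q₂ y))) l && decide (Q₁ l ∨ Q₂ l))).Reachable c s))).card *
      (univ : Finset (α → Bool)).card =
    (univ.filter fun z : α → Bool =>
        (((¬ (openGraph (labelledOpen ends fun l => z l && decide (Q₁ l))).Reachable s a ∧
        ¬ (openGraph (labelledOpen ends fun l => z l && decide (Q₁ l))).Reachable s c) ∧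
        (¬ (openGraph (labelledOpen ends fun l => z l && decide (Q₁ l))).Reachable c a ∧
        ¬ (openGraph (labelledOpen ends fun l => z l && decide (Q₁ l))).Reachable c s)) ∧
        (¬ (openGraph (labelledOpen ends fun l =>
          clusterFlip ends a (fun y => !(z y && decide (Q₁ y))) l && decide (Q₁ l))).Reachable c a ∧
        ¬ (openGraph (labelledOpen ends fun l =>
          clusterFlip ends a (fun y => !(z y && decide (Q₁ y))) l && decide (Q₁ l))).Reachable c s))).card *
    (univ.filter fun z : α → Bool =>
        (((¬ (openGraph (labelledOpen ends fun l => z l && decide (Q₂ l))).Reachable s a ∧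
        ¬ (openGraph (labelledOpen ends fun l => z l && decide (Q₂ l))).Reachable s c) ∧
        (¬ (openGraph (labelledOpen ends fun l => z l && decide (Q₂ l))).Reachable c a ∧
        ¬ (openGraph (labelledOpen ends fun l => z l && decide (Q₂ l))).Reachable c s)) ∧
        (¬ (openGraph (labelledOpen ends fun l =>
          clusterFlip ends a (fun y => !(z y && decide (Q₂ y))) l && decide (Q₂ l))).Reachable c a ∧
        ¬ (openGraph (labelledOpen ends fun l =>
          clusterFlip ends a (fun y => !(z y && decide (Q₂ y))) l && decide (Q₂ l))).Reachable c s))).card := by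
  refine card_mul_univ_of_restrict_split Q₁ Q₂ hQ _
    (fun w =>
        (((¬ (openGraph (labelledOpen ends w)).Reachable s a ∧
        ¬ (openGraph (labelledOpen ends w)).Reachable s c) ∧
        (¬ (openGraph (labelledOpen ends w)).Reachable c a ∧
        ¬ (openGraph (labelledOpen ends w)).Reachable c s)) ∧
        (¬ (openGraph (labelledOpen ends fun l => clusterFlip ends a (fun y => !(w y)) l && decide (Q₁ l))).Reachable c a ∧
        ¬ (openGraph (labelledOpen ends fun l => clusterFlip ends a (fun y => !(w y)) l && decide (Q₁ l))).Reachable c s)))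
    (fun w =>
        (((¬ (openGraph (labelledOpen ends w)).Reachable s a ∧
        ¬ (openGraph (labelledOpen ends w)).Reachable s c) ∧
        (¬ (openGraph (labelledOpen ends w)).Reachable c a ∧
        ¬ (openGraph (labelledOpen ends w)).Reachable c s)) ∧
        (¬ (openGraph (labelledOpen ends fun l => clusterFlip ends a (fun y => !(w y)) l && decide (Q₂ l))).Reachable c a ∧
        ¬ (openGraph (labelledOpen ends fun l => clusterFlip ends a (fun y => !(w y)) l && decide (Q₂ l))).Reachable c s)))
    fun z => ?_
  obtain ⟨hs, hc, hF⟩ := events_split ends s a c P₁ P₂ Q₁ Q₂ hQP₁ hQP₂ hPT₁ hPT₂ hP z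
  constructor
  · intro h
    obtain ⟨hS, hfl⟩ := h
    have hS' := (and_congr hs hc).1 hS
    have hF' := hF hS
    exact ⟨⟨⟨hS'.1.1, hS'.2.1⟩, (hF'.2.1 hfl).1⟩, ⟨⟨hS'.1.2, hS'.2.2⟩, (hF'.2.1 hfl).2⟩⟩
  · intro h
    obtain ⟨⟨hS1, hf1⟩, ⟨hS2, hf2⟩⟩ := h
    have hS := (and_congr hs hc).2 ⟨⟨hS1.1, hS2.1⟩, ⟨hS1.2, hS2.2⟩⟩
    exact ⟨hS, ((hF hS).2).2 ⟨hf1, hf2⟩⟩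


open Classical in
/-- **`Gb` (S0, and s isolated in the restricted flat) multiplies under parallel composition**: `#E(Q₁∪Q₂) · 2^{#α} = #E(Q₁) · #E(Q₂)`. [this work] -/
theorem card_parallel_Gb
    (hQP₁ : ∀ l, Q₁ l → ∀ v ∈ ends l, P₁ v ∨ (v = s ∨ v = a ∨ v = c))
    (hQP₂ : ∀ l, Q₂ l → ∀ v ∈ ends l, P₂ v ∨ (v = s ∨ v = a ∨ v = c))
    (hPT₁ : ∀ v, P₁ v → ¬ (v = s ∨ v = a ∨ v = c)) (hPT₂ : ∀ v, P₂ v → ¬ (v = s ∨ v = a ∨ v = c))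
    (hP : ∀ v, P₁ v → ¬ P₂ v) (hQ : ∀ l, Q₁ l → ¬ Q₂ l) :
    (univ.filter fun z : α → Bool =>
        (((¬ (openGraph (labelledOpen ends fun l => z l && decide (Q₁ l ∨ Q₂ l))).Reachable s a ∧
        ¬ (openGraph (labelledOpen ends fun l => z l && decide (Q₁ l ∨ Q₂ l))).Reachable s c) ∧
        (¬ (openGraph (labelledOpen ends fun l => z l && decide (Q₁ l ∨ Q₂ l))).Reachable c a ∧
        ¬ (openGraph (labelledOpen ends fun l => z l && decide (Q₁ l ∨ Q₂ l))).Reachable c s)) ∧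
        (¬ (openGraph (labelledOpen ends fun l =>
          clusterFlip ends a (fun y => !(z y && decide (Q₁ y ∨ Q₂ y))) l && decide (Q₁ l ∨ Q₂ l))).Reachable s a ∧
        ¬ (openGraph (labelledOpen ends fun l =>
          clusterFlip ends a (fun y => !(z y && decide (Q₁ y ∨ Q₂ y))) l && decide (Q₁ l ∨ Q₂ l))).Reachable s c))).card *
      (univ : Finset (α → Bool)).card =
    (univ.filter fun z : α → Bool =>
        (((¬ (openGraph (labelledOpen ends fun l => z l && decide (Q₁ l))).Reachable s a ∧
        ¬ (openGraph (labelledOpen ends fun l => z l && decide (Q₁ l))).Reachable s c) ∧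
        (¬ (openGraph (labelledOpen ends fun l => z l && decide (Q₁ l))).Reachable c a ∧
        ¬ (openGraph (labelledOpen ends fun l => z l && decide (Q₁ l))).Reachable c s)) ∧
        (¬ (openGraph (labelledOpen ends fun l =>
          clusterFlip ends a (fun y => !(z y && decide (Q₁ y))) l && decide (Q₁ l))).Reachable s a ∧
        ¬ (openGraph (labelledOpen ends fun l =>
          clusterFlip ends a (fun y => !(z y && decide (Q₁ y))) l && decide (Q₁ l))).Reachable s c))).card *
    (univ.filter fun z : α → Bool =>
        (((¬ (openGraph (labelledOpen ends fun l => z l && decide (Q₂ l))).Reachable s a ∧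
        ¬ (openGraph (labelledOpen ends fun l => z l && decide (Q₂ l))).Reachable s c) ∧
        (¬ (openGraph (labelledOpen ends fun l => z l && decide (Q₂ l))).Reachable c a ∧
        ¬ (openGraph (labelledOpen ends fun l => z l && decide (Q₂ l))).Reachable c s)) ∧
        (¬ (openGraph (labelledOpen ends fun l =>
          clusterFlip ends a (fun y => !(z y && decide (Q₂ y))) l && decide (Q₂ l))).Reachable s a ∧
        ¬ (openGraph (labelledOpen ends fun l =>
          clusterFlip ends a (fun y => !(z y && decide (Q₂ y))) l && decide (Q₂ l))).Reachable s c))).card := by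
  refine card_mul_univ_of_restrict_split Q₁ Q₂ hQ _
    (fun w =>
        (((¬ (openGraph (labelledOpen ends w)).Reachable s a ∧
        ¬ (openGraph (labelledOpen ends w)).Reachable s c) ∧
        (¬ (openGraph (labelledOpen ends w)).Reachable c a ∧
        ¬ (openGraph (labelledOpen ends w)).Reachable c s)) ∧
        (¬ (openGraph (labelledOpen ends fun l => clusterFlip ends a (fun y => !(w y)) l && decide (Q₁ l))).Reachable s a ∧
        ¬ (openGraph (labelledOpen ends fun l => clusterFlip ends a (fun y => !(w y)) l && decide (Q₁ l))).Reachable s c)))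
    (fun w =>
        (((¬ (openGraph (labelledOpen ends w)).Reachable s a ∧
        ¬ (openGraph (labelledOpen ends w)).Reachable s c) ∧
        (¬ (openGraph (labelledOpen ends w)).Reachable c a ∧
        ¬ (openGraph (labelledOpen ends w)).Reachable c s)) ∧
        (¬ (openGraph (labelledOpen ends fun l => clusterFlip ends a (fun y => !(w y)) l && decide (Q₂ l))).Reachable s a ∧
        ¬ (openGraph (labelledOpen ends fun l => clusterFlip ends a (fun y => !(w y)) l && decide (Q₂ l))).Reachable s c)))
    fun z => ?_
  obtain ⟨hs, hc, hF⟩ := events_split ends s a c P₁ P₂ Q₁ Q₂ hQP₁ hQP₂ hPT₁ hPT₂ hP z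
  constructor
  · intro h
    obtain ⟨hS, hfl⟩ := h
    have hS' := (and_congr hs hc).1 hS
    have hF' := hF hS
    exact ⟨⟨⟨hS'.1.1, hS'.2.1⟩, (hF'.1.1 hfl).1⟩, ⟨⟨hS'.1.2, hS'.2.2⟩, (hF'.1.1 hfl).2⟩⟩
  · intro h
    obtain ⟨⟨hS1, hf1⟩, ⟨hS2, hf2⟩⟩ := h
    have hS := (and_congr hs hc).2 ⟨⟨hS1.1, hS2.1⟩, ⟨hS1.2, hS2.2⟩⟩
    exact ⟨hS, ((hF hS).1).2 ⟨hf1, hf2⟩⟩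


open Classical in
/-- **`G1` (S0, and s, c isolated in the restricted flat) multiplies under parallel composition**: `#E(Q₁∪Q₂) · 2^{#α} = #E(Q₁) · #E(Q₂)`. [this work] -/
theorem card_parallel_G1
    (hQP₁ : ∀ l, Q₁ l → ∀ v ∈ ends l, P₁ v ∨ (v = s ∨ v = a ∨ v = c))
    (hQP₂ : ∀ l, Q₂ l → ∀ v ∈ ends l, P₂ v ∨ (v = s ∨ v = a ∨ v = c))
    (hPT₁ : ∀ v, P₁ v → ¬ (v = s ∨ v = a ∨ v = c)) (hPT₂ : ∀ v, P₂ v → ¬ (v = s ∨ v = a ∨ v = c))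
    (hP : ∀ v, P₁ v → ¬ P₂ v) (hQ : ∀ l, Q₁ l → ¬ Q₂ l) :
    (univ.filter fun z : α → Bool =>
        (((¬ (openGraph (labelledOpen ends fun l => z l && decide (Q₁ l ∨ Q₂ l))).Reachable s a ∧
        ¬ (openGraph (labelledOpen ends fun l => z l && decide (Q₁ l ∨ Q₂ l))).Reachable s c) ∧
        (¬ (openGraph (labelledOpen ends fun l => z l && decide (Q₁ l ∨ Q₂ l))).Reachable c a ∧
        ¬ (openGraph (labelledOpen ends fun l => z l && decide (Q₁ l ∨ Q₂ l))).Reachable c s)) ∧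
        ((¬ (openGraph (labelledOpen ends fun l =>
          clusterFlip ends a (fun y => !(z y && decide (Q₁ y ∨ Q₂ y))) l && decide (Q₁ l ∨ Q₂ l))).Reachable s a ∧
        ¬ (openGraph (labelledOpen ends fun l =>
          clusterFlip ends a (fun y => !(z y && decide (Q₁ y ∨ Q₂ y))) l && decide (Q₁ l ∨ Q₂ l))).Reachable s c) ∧
        (¬ (openGraph (labelledOpen ends fun l =>
          clusterFlip ends a (fun y => !(z y && decide (Q₁ y ∨ Q₂ y))) l && decide (Q₁ l ∨ Q₂ l))).Reachable c a ∧
        ¬ (openGraph (labelledOpen ends fun l =>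
          clusterFlip ends a (fun y => !(z y && decide (Q₁ y ∨ Q₂ y))) l && decide (Q₁ l ∨ Q₂ l))).Reachable c s)))).card *
      (univ : Finset (α → Bool)).card =
    (univ.filter fun z : α → Bool =>
        (((¬ (openGraph (labelledOpen ends fun l => z l && decide (Q₁ l))).Reachable s a ∧
        ¬ (openGraph (labelledOpen ends fun l => z l && decide (Q₁ l))).Reachable s c) ∧
        (¬ (openGraph (labelledOpen ends fun l => z l && decide (Q₁ l))).Reachable c a ∧
        ¬ (openGraph (labelledOpen ends fun l => z l && decide (Q₁ l))).Reachable c s)) ∧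
        ((¬ (openGraph (labelledOpen ends fun l =>
          clusterFlip ends a (fun y => !(z y && decide (Q₁ y))) l && decide (Q₁ l))).Reachable s a ∧
        ¬ (openGraph (labelledOpen ends fun l =>
          clusterFlip ends a (fun y => !(z y && decide (Q₁ y))) l && decide (Q₁ l))).Reachable s c) ∧
        (¬ (openGraph (labelledOpen ends fun l =>
          clusterFlip ends a (fun y => !(z y && decide (Q₁ y))) l && decide (Q₁ l))).Reachable c a ∧
        ¬ (openGraph (labelledOpen ends fun l =>
          clusterFlip ends a (fun y => !(z y && decide (Q₁ y))) l && decide (Q₁ l))).Reachable c s)))).card *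
    (univ.filter fun z : α → Bool =>
        (((¬ (openGraph (labelledOpen ends fun l => z l && decide (Q₂ l))).Reachable s a ∧
        ¬ (openGraph (labelledOpen ends fun l => z l && decide (Q₂ l))).Reachable s c) ∧
        (¬ (openGraph (labelledOpen ends fun l => z l && decide (Q₂ l))).Reachable c a ∧
        ¬ (openGraph (labelledOpen ends fun l => z l && decide (Q₂ l))).Reachable c s)) ∧
        ((¬ (openGraph (labelledOpen ends fun l =>
          clusterFlip ends a (fun y => !(z y && decide (Q₂ y))) l && decide (Q₂ l))).Reachable s a ∧
        ¬ (openGraph (labelledOpen ends fun l =>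
          clusterFlip ends a (fun y => !(z y && decide (Q₂ y))) l && decide (Q₂ l))).Reachable s c) ∧
        (¬ (openGraph (labelledOpen ends fun l =>
          clusterFlip ends a (fun y => !(z y && decide (Q₂ y))) l && decide (Q₂ l))).Reachable c a ∧
        ¬ (openGraph (labelledOpen ends fun l =>
          clusterFlip ends a (fun y => !(z y && decide (Q₂ y))) l && decide (Q₂ l))).Reachable c s)))).card := by
  refine card_mul_univ_of_restrict_split Q₁ Q₂ hQ _
    (fun w =>
        (((¬ (openGraph (labelledOpen ends w)).Reachable s a ∧
        ¬ (openGraph (labelledOpen ends w)).Reachable s c) ∧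
        (¬ (openGraph (labelledOpen ends w)).Reachable c a ∧
        ¬ (openGraph (labelledOpen ends w)).Reachable c s)) ∧
        ((¬ (openGraph (labelledOpen ends fun l => clusterFlip ends a (fun y => !(w y)) l && decide (Q₁ l))).Reachable s a ∧
        ¬ (openGraph (labelledOpen ends fun l => clusterFlip ends a (fun y => !(w y)) l && decide (Q₁ l))).Reachable s c) ∧
        (¬ (openGraph (labelledOpen ends fun l => clusterFlip ends a (fun y => !(w y)) l && decide (Q₁ l))).Reachable c a ∧
        ¬ (openGraph (labelledOpen ends fun l => clusterFlip ends a (fun y => !(w y)) l && decide (Q₁ l))).Reachable c s))))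
    (fun w =>
        (((¬ (openGraph (labelledOpen ends w)).Reachable s a ∧
        ¬ (openGraph (labelledOpen ends w)).Reachable s c) ∧
        (¬ (openGraph (labelledOpen ends w)).Reachable c a ∧
        ¬ (openGraph (labelledOpen ends w)).Reachable c s)) ∧
        ((¬ (openGraph (labelledOpen ends fun l => clusterFlip ends a (fun y => !(w y)) l && decide (Q₂ l))).Reachable s a ∧
        ¬ (openGraph (labelledOpen ends fun l => clusterFlip ends a (fun y => !(w y)) l && decide (Q₂ l))).Reachable s c) ∧
        (¬ (openGraph (labelledOpen ends fun l => clusterFlip ends a (fun y => !(w y)) l && decide (Q₂ l))).Reachable c a ∧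
        ¬ (openGraph (labelledOpen ends fun l => clusterFlip ends a (fun y => !(w y)) l && decide (Q₂ l))).Reachable c s))))
    fun z => ?_
  obtain ⟨hs, hc, hF⟩ := events_split ends s a c P₁ P₂ Q₁ Q₂ hQP₁ hQP₂ hPT₁ hPT₂ hP z
  constructor
  · intro h
    obtain ⟨hS, hfl⟩ := h
    have hS' := (and_congr hs hc).1 hS
    have hF' := hF hS
    exact ⟨⟨⟨hS'.1.1, hS'.2.1⟩, (hF'.1.1 hfl.1).1, (hF'.2.1 hfl.2).1⟩,
      ⟨⟨hS'.1.2, hS'.2.2⟩, (hF'.1.1 hfl.1).2, (hF'.2.1 hfl.2).2⟩⟩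
  · intro h
    obtain ⟨⟨hS1, hf1, hg1⟩, ⟨hS2, hf2, hg2⟩⟩ := h
    have hS := (and_congr hs hc).2 ⟨⟨hS1.1, hS2.1⟩, ⟨hS1.2, hS2.2⟩⟩
    exact ⟨hS, ((hF hS).1).2 ⟨hf1, hf2⟩, ((hF hS).2).2 ⟨hg1, hg2⟩⟩

end Counts

end Summit.CriticalPhenomena.PercolationContinuityZ3.Theorems.ProductFormFibre
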